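import Mathlib
import HarnessLib

/-!
# Armstrong (1968): the orbit space of a finite group generated by elements with fixed points
# is simply connected

Named fact (sorry-free `def … : Prop`, D-0014) vendoring the special case used in 4-manifold
topology of M. A. Armstrong, *The fundamental group of the orbit space of a discontinuous group*,
Proc. Cambridge Philos. Soc. 64 (1968), 299–301, Theorem (p. 299), as printed:

> "Let `G` be a discontinuous group of homeomorphisms of a path connected, simply connected,
> locally compact metric space `X`, and let `H` be the normal subgroup of `G` generated by those
> elements which have fixed points. Then the fundamental group of the orbit space `X/G` is
> isomorphic to the factor group `G/H`."

We record the consequence for `H = G`: if `G` is generated by elements having fixed points, the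
orbit space `X/G` is simply connected. (The subgroup generated by the elements with a fixed point
is automatically normal — a conjugate of an element fixing `x` fixes `g • x` — so "normal subgroup
generated by" and "subgroup generated by" agree.)

## Rendering

* `G` a FINITE group acting on `X` by homeomorphisms (`MulAction G X`, `ContinuousConstSMul G X`):
  a finite group of homeomorphisms of a locally compact Hausdorff space is discontinuous in
  Armstrong's sense (properly discontinuous), so this is a special case of the printed hypothesis.
  Faithfulness of the action is not assumed: the theorem applies to the image of `G` in
  `Homeo(X)`, which has the same orbits, and the image is again generated by (images of) elements
  with fixed points.
* `X` a locally compact metric space (`MetricSpace X`, `LocallyCompactSpace X`), simply connected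
  (`SimplyConnectedSpace X`, which includes path connectedness), as printed.
* The orbit space is Mathlib's `MulAction.orbitRel.Quotient G X` with the quotient topology;
  conclusion `SimplyConnectedSpace` of it.
* Hypothesis "`G` is generated by elements which have fixed points":
  `Subgroup.closure {g | ∃ x, g • x = x} = ⊤`.

## Use

Route `SmoothPoincare4/RealQuotientSpheres`, support item `RqHomotopySphere`
(`Summit.SmoothPoincare4.SmoothPoincare4.Theses.RealQuotientSpheres.RqHomotopySphere`): for a
complex surface `X` with an anti-holomorphic involution `σ` having a real point, `G = ℤ/2 = ⟨σ⟩` is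
generated by an element with a fixed point, so the Arnold–Rokhlin quotient `Y = X/σ` is simply
connected (Finashin 1996, §1; the remaining steps to `Y ≃ S⁴` are the transfer
`H²(Y;ℚ) = H²(X;ℚ)^σ` and Freedman's theorem, tree fact
`Literature.Topology.FourManifolds.nonempty_homotopyEquiv_sphere_four_iff`). Users take
`(h : armstrong1968_orbitSpace_simplyConnected)` as a hypothesis and transport along a
homeomorphism `Y ≃ₜ orbitRel.Quotient`.

## Search record (grounder, 2026-08-15)

`lean search 'Armstrong1968|orbit space.*simply|orbitRel.*SimplyConnected'`: nothing in Mathlib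
(pin v4.32) or the tree computes `π₁` of an orbit space; Mathlib has `SimplyConnectedSpace`,
`MulAction.orbitRel.Quotient` and its quotient topology, which is all the statement needs.
-/

namespace Literature.AlgebraicTopology.FundamentalGroup

/-- **Armstrong 1968** (Proc. Cambridge Philos. Soc. 64 (1968) 299–301, Theorem p. 299, the case
`H = G`): if a finite group `G` acts by homeomorphisms on a simply connected, locally compact
metric space `X` and `G` is generated by elements each of which has a fixed point, then the orbit
space `X/G` (quotient topology) is simply connected. Printed theorem: for a discontinuous group
`G` of homeomorphisms of a path connected, simply connected, locally compact metric space,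
`π₁(X/G) ≅ G/H` with `H` the normal subgroup generated by the elements having fixed points; here
`H = G`, finite `G` (a special case of discontinuous), and the action need not be faithful (apply
the theorem to the image of `G` in the homeomorphism group: same orbits, same generation
property). Grounds the `π₁(Y) = 1` step of
`Summit.SmoothPoincare4.SmoothPoincare4.Theses.RealQuotientSpheres.RqHomotopySphere`
(`G = ⟨σ⟩ ≅ ℤ/2`, `σ` with a real point). [cite: Armstrong1968, Theorem (p. 299)] -/
def armstrong1968_orbitSpace_simplyConnected : Prop :=
  ∀ (G X : Type) [Group G] [Finite G] [MetricSpace X] [LocallyCompactSpace X]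
    [SimplyConnectedSpace X] [MulAction G X] [ContinuousConstSMul G X],
    Subgroup.closure {g : G | ∃ x : X, g • x = x} = ⊤ →
      SimplyConnectedSpace (MulAction.orbitRel.Quotient G X)

end Literature.AlgebraicTopology.FundamentalGroup
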